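import Literature.NumberTheory.EllipticCurves.KodairaDiscriminantValuesTwoProofs
import Literature.NumberTheory.DiophantineGeometry.TateAlgorithmIstarSuccNormalFormProofs
import Literature.NumberTheory.DiophantineGeometry.TateAlgorithmOggBound
import Literature.NumberTheory.DiophantineGeometry.TateAlgorithmAdditiveProofs
import Literature.NumberTheory.DiophantineGeometry.ConductorAdditiveProofs
import Literature.NumberTheory.DiophantineGeometry.ConductorExponentLeFiveProofs
import Literature.NumberTheory.DiophantineGeometry.ConductorFactorizationProofs
import Literature.NumberTheory.DiophantineGeometry.MinimalDiscriminantFactorizationProofs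
import Literature.NumberTheory.DiophantineGeometry.EllArithGlueProofs
import Literature.NumberTheory.DiophantineGeometry.KodairaSymbolProofs
import HarnessLib

/-!
# Type `Iₙ*` (`n ≥ 1`) is wild in residue characteristic `2`; the additive types with `f = 2`
# at an absolutely unramified `2`-adic place are `IV` and `IV*`

Companion proof file (theorems only; no definitions, no named facts, no instances) of
`Literature.NumberTheory.DiophantineGeometry.TateAlgorithm` and `…Conductor`.

The tree *defines* the conductor exponent by Ogg's formula `f_v = ord_v(Δ_min) + 1 - m_v`
(`WeierstrassCurve.conductorExponent`), so that for a given Kodaira type the value of `f_v` is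
read off from `ord_v(Δ_min)`.  Silverman, *ATAEC* IV.9.4 Step 7 (PDF pp. 345–346) computes the
index `n` of type `Iₙ*` by the sub-procedure `istarIndexAux`: at round `m` the model is
normalised to `π ∣ a₁`, `π ∥ a₂`, `π^{m+2} ∣ a₃`, `π^{m+3} ∣ a₄`, `π^{2m+4} ∣ a₆`, and the two
exits return `n = 2m + 1`, resp. `n = 2m + 2` (after the `y`-translation making
`π^{m+3} ∣ a₃`, `π^{2m+5} ∣ a₆`).  In any residue characteristic this gives `ord Δ ≥ n + 6`
(`OggBound.Δ_mem_pow_istarIndexAux`), with equality when `2` is a unit.  **When `2 ∈ 𝔪`**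
(residue characteristic `2`, any ramification) the literal coefficients `4` in
`b₂ = a₁² + 4a₂`, `b₆ = a₃² + 4a₆`, `2` in `b₄ = 2a₄ + a₁a₃` and `8` in
`Δ = -b₂²b₈ - 8b₄³ - 27b₆² + 9b₂b₄b₆` raise the orders: on the round-`m` model
`ord b₂ ≥ 2`, `ord b₄ ≥ m + 3`, `ord b₆ ≥ 2m + 4`, `ord b₈ ≥ 2m + 5`, hence `ord Δ ≥ 2m + 8`
(`Δ_mem_pow_of_istarRoundA_of_two_mem`), and after the `y`-translation `ord Δ ≥ 2m + 10`
(`Δ_mem_pow_of_istarRoundB_of_two_mem`).  Following the sub-procedure exactly as in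
`OggBound.Δ_mem_pow_istarIndexAux` this yields

* `TateAlgorithm.CharTwo.Δ_mem_pow_istarIndexAux_of_two_mem`,
  `TateAlgorithm.CharTwo.Δ_mem_pow_istarIndex_of_two_mem` — `π ^ (2⌊n/2⌋ + 8) ∣ Δ` for the
  index `n` returned, i.e. `ord Δ ≥ n + 7`, and `ord Δ ≥ n + 8` when `n` is even;
* `TateAlgorithm.CharTwo.le_addVal_Δ_toNat_of_kodairaSymbolOfMinimal_eq_Istar_succ_of_two_mem`
  — for the output `Istar (n + 1)` of the literal implementation `kodairaSymbolOfMinimal`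
  (bookkeeping of Steps 2, 6, 7 as in
  `addVal_Δ_toNat_eq_of_kodairaSymbolOfMinimal_eq_Istar_succ`): `ord Δ ≥ (n + 1) + 7`, and
  `≥ (n + 1) + 8` if `n + 1` is even.

So **type `Iₙ*`, `n ≥ 1`, has `f_v ≥ 3` (wild) at every place of residue characteristic `2`**
(`WeierstrassCurve.three_le_conductorExponent_of_kodairaSymbolAt_eq_Istar_succ_of_two_mem`;
`f_v ≥ 4` for even `n`).  Combined with the tree's discriminant sets at a place where `2` is a
uniformiser (`O_v` absolutely unramified, e.g. `ℚ₂`) — `II`: `{4, 6, 7}`, `III`: `{4, 6, 8, 9}`,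
`I₀*`: `{8, 9, 10}`, `III*`: `{10, 12, 14, 15}`, `II*`: `{11, 12, 14}`
(`KodairaDiscriminantValuesTwoProofs`) — and `f_v ≥ 2 ⇔` additive
(`two_le_conductorExponent_iff_holds`, `isAdditive_kodairaSymbolAt_iff_holds`), the case analysis
over the Kodaira symbol gives

* `WeierstrassCurve.kodairaSymbolAt_of_conductorExponent_eq_two_of_irreducible_two` — **if `2`
  is a uniformiser of `O_v` and `f_v = 2`, then the Kodaira type at `v` is `IV` with
  `ord_v(Δ_min) = 4` or `IV*` with `ord_v(Δ_min) = 8`**; over `ℚ` at `2`: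
  `WeierstrassCurve.kodairaSymbolAt_of_conductorExponent_eq_two_two` (place of `ℤ`) and, in the
  global currency `4 ∥ N_E`, `WeierstrassCurve.padicValInt_two_minimalDiscriminantInt_of_four_dvd_conductorNorm`
  (`ord₂(Δ_min) ∈ {4, 8}` for a globally minimal equation).

This is the row structure of Papadopoulos's table for `p = 2` (types `IV`, `IV*` are the only
additive types with `v(N) = 2` over `ℚ₂`), obtained here directly from Tate's algorithm; the
cell `bsd-f2-manin` uses it as the law "`4 ∥ N ⇒ v₂(Δ_min) ∈ {4, 8}`" (checked on
`215 648 / 215 648` census classes, and `f₂ ≥ 3` for `Iₙ*`, `n ≥ 1`, on `368 032 / 368 032`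
Cremona classes, `f₂ ≥ 4` for even `n` included).

## References

* J. H. Silverman, *Advanced Topics in the Arithmetic of Elliptic Curves*, GTM 151, Springer
  1994, IV.9.4 Step 7 (PDF pp. 345–346), Table 4.1 (PDF p. 343), IV.10–IV.11.1.
  [SilvermanATAEC1994]
* I. Papadopoulos, *Sur la classification de Néron des courbes elliptiques en caractéristique
  résiduelle 2 et 3*, J. Number Theory 44 (1993), 119–152, Table IV (`p = 2`).
  [Papadopoulos1993]
-/

open Polynomial IsLocalRing
open IsDiscreteValuationRing hiding maximalIdeal

namespace Literature.NumberTheory.DiophantineGeometry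

namespace TateAlgorithm

namespace CharTwo

/-! ### Orders of the `bᵢ` and of `Δ` when `2 ∈ I` -/

section IdealPow

variable {S : Type*} [CommRing S] {I : Ideal S} (W : WeierstrassCurve S)

open OggBound

/-- Order of `b₂ = a₁² + 4a₂` when `2 ∈ I`: `e ≤ 2·ord a₁`, `e ≤ ord a₂ + 2`. [folklore] -/
private theorem b₂_mem_pow_of_two_mem (h2 : (2 : S) ∈ I) {n₁ n₂ e : ℕ} (h1 : W.a₁ ∈ I ^ n₁)
    (h₂ : W.a₂ ∈ I ^ n₂) (he1 : e ≤ n₁ + n₁ := by omega) (he2 : e ≤ 2 + n₂ := by omega) :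
    W.b₂ ∈ I ^ e := by
  have h4 : (4 : S) ∈ I ^ 2 := by
    rw [show (4 : S) = 2 * 2 by norm_num, pow_two]; exact Ideal.mul_mem_mul h2 h2
  have eq : W.b₂ = W.a₁ * W.a₁ + 4 * W.a₂ := by rw [WeierstrassCurve.b₂]; ring
  rw [eq]
  exact add_mem (Ideal.pow_le_pow_right he1 (mul_mem_pow_add h1 h1))
    (Ideal.pow_le_pow_right he2 (mul_mem_pow_add h4 h₂))

/-- Order of `b₄ = 2a₄ + a₁a₃` when `2 ∈ I`: `e ≤ ord a₄ + 1`, `e ≤ ord a₁ + ord a₃`.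
[folklore] -/
private theorem b₄_mem_pow_of_two_mem (h2 : (2 : S) ∈ I) {n₁ n₃ n₄ e : ℕ} (h1 : W.a₁ ∈ I ^ n₁)
    (h3 : W.a₃ ∈ I ^ n₃) (h4 : W.a₄ ∈ I ^ n₄) (he1 : e ≤ 1 + n₄ := by omega)
    (he2 : e ≤ n₁ + n₃ := by omega) : W.b₄ ∈ I ^ e := by
  have h2₁ : (2 : S) ∈ I ^ 1 := by rwa [pow_one]
  have eq : W.b₄ = 2 * W.a₄ + W.a₁ * W.a₃ := by rw [WeierstrassCurve.b₄]
  rw [eq]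
  exact add_mem (Ideal.pow_le_pow_right he1 (mul_mem_pow_add h2₁ h4))
    (Ideal.pow_le_pow_right he2 (mul_mem_pow_add h1 h3))

/-- Order of `b₆ = a₃² + 4a₆` when `2 ∈ I`: `e ≤ 2·ord a₃`, `e ≤ ord a₆ + 2`. [folklore] -/
private theorem b₆_mem_pow_of_two_mem (h2 : (2 : S) ∈ I) {n₃ n₆ e : ℕ} (h3 : W.a₃ ∈ I ^ n₃)
    (h6 : W.a₆ ∈ I ^ n₆) (he1 : e ≤ n₃ + n₃ := by omega) (he2 : e ≤ 2 + n₆ := by omega) :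
    W.b₆ ∈ I ^ e := by
  have h4 : (4 : S) ∈ I ^ 2 := by
    rw [show (4 : S) = 2 * 2 by norm_num, pow_two]; exact Ideal.mul_mem_mul h2 h2
  have eq : W.b₆ = W.a₃ * W.a₃ + 4 * W.a₆ := by rw [WeierstrassCurve.b₆]; ring
  rw [eq]
  exact add_mem (Ideal.pow_le_pow_right he1 (mul_mem_pow_add h3 h3))
    (Ideal.pow_le_pow_right he2 (mul_mem_pow_add h4 h6))

/-- Order of `b₈ = a₁²a₆ + 4a₂a₆ - a₁a₃a₄ + a₂a₃² - a₄²` when `2 ∈ I`. [folklore] -/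
private theorem b₈_mem_pow_of_two_mem (h2 : (2 : S) ∈ I) {n₁ n₂ n₃ n₄ n₆ e : ℕ} (h1 : W.a₁ ∈ I ^ n₁)
    (h₂ : W.a₂ ∈ I ^ n₂) (h3 : W.a₃ ∈ I ^ n₃) (h4 : W.a₄ ∈ I ^ n₄) (h6 : W.a₆ ∈ I ^ n₆)
    (he1 : e ≤ n₁ + n₁ + n₆ := by omega) (he2 : e ≤ 2 + (n₂ + n₆) := by omega)
    (he3 : e ≤ n₁ + n₃ + n₄ := by omega) (he4 : e ≤ n₂ + n₃ + n₃ := by omega)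
    (he5 : e ≤ n₄ + n₄ := by omega) : W.b₈ ∈ I ^ e := by
  have h4' : (4 : S) ∈ I ^ 2 := by
    rw [show (4 : S) = 2 * 2 by norm_num, pow_two]; exact Ideal.mul_mem_mul h2 h2
  have eq : W.b₈ = W.a₁ * W.a₁ * W.a₆ + 4 * (W.a₂ * W.a₆) - W.a₁ * W.a₃ * W.a₄ +
      W.a₂ * W.a₃ * W.a₃ - W.a₄ * W.a₄ := by
    rw [WeierstrassCurve.b₈]; ring
  rw [eq]
  refine sub_mem (add_mem (sub_mem (add_mem ?_ ?_) ?_) ?_) ?_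
  · exact Ideal.pow_le_pow_right he1 (mul_mem_pow_add (mul_mem_pow_add h1 h1) h6)
  · exact Ideal.pow_le_pow_right he2 (mul_mem_pow_add h4' (mul_mem_pow_add h₂ h6))
  · exact Ideal.pow_le_pow_right he3 (mul_mem_pow_add (mul_mem_pow_add h1 h3) h4)
  · exact Ideal.pow_le_pow_right he4 (mul_mem_pow_add (mul_mem_pow_add h₂ h3) h3)
  · exact Ideal.pow_le_pow_right he5 (mul_mem_pow_add h4 h4)

/-- Order of `Δ = -b₂²b₈ - 8b₄³ - 27b₆² + 9b₂b₄b₆` when `2 ∈ I` (so `8 ∈ I³`). [folklore] -/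
theorem Δ_mem_pow_of_b_of_two_mem (h2 : (2 : S) ∈ I) {e₂ e₄ e₆ e₈ N : ℕ} (hb2 : W.b₂ ∈ I ^ e₂)
    (hb4 : W.b₄ ∈ I ^ e₄) (hb6 : W.b₆ ∈ I ^ e₆) (hb8 : W.b₈ ∈ I ^ e₈)
    (hN1 : N ≤ e₂ + e₂ + e₈ := by omega) (hN2 : N ≤ 3 + (e₄ + e₄ + e₄) := by omega)
    (hN3 : N ≤ e₆ + e₆ := by omega) (hN4 : N ≤ e₂ + e₄ + e₆ := by omega) : W.Δ ∈ I ^ N := by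
  have h8 : (8 : S) ∈ I ^ 3 := by
    rw [show (8 : S) = 2 * 2 * 2 by norm_num, show (3 : ℕ) = 1 + 1 + 1 from rfl, pow_add,
      pow_add, pow_one]
    exact Ideal.mul_mem_mul (Ideal.mul_mem_mul h2 h2) h2
  have eq : W.Δ = -(W.b₂ * W.b₂ * W.b₈) - 8 * (W.b₄ * W.b₄ * W.b₄) - 27 * (W.b₆ * W.b₆) +
      9 * (W.b₂ * W.b₄ * W.b₆) := by
    rw [WeierstrassCurve.Δ]; ring
  rw [eq]
  refine add_mem (sub_mem (sub_mem ?_ ?_) ?_) ?_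
  · exact neg_mem (Ideal.pow_le_pow_right hN1 (mul_mem_pow_add (mul_mem_pow_add hb2 hb2) hb8))
  · exact Ideal.pow_le_pow_right hN2
      (mul_mem_pow_add h8 (mul_mem_pow_add (mul_mem_pow_add hb4 hb4) hb4))
  · exact Ideal.mul_mem_left _ _ (Ideal.pow_le_pow_right hN3 (mul_mem_pow_add hb6 hb6))
  · exact Ideal.mul_mem_left _ _
      (Ideal.pow_le_pow_right hN4 (mul_mem_pow_add (mul_mem_pow_add hb2 hb4) hb6))

/-- Order of `Δ` from orders `nᵢ` of the `aᵢ` when `2 ∈ I`, through chosen orders `eᵢ` of the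
`bᵢ` (all inequalities discharged by `omega` at the call sites). [folklore] -/
theorem Δ_mem_pow_of_a_of_two_mem (h2 : (2 : S) ∈ I) {n₁ n₂ n₃ n₄ n₆ : ℕ} (e₂ e₄ e₆ e₈ : ℕ)
    {N : ℕ} (h1 : W.a₁ ∈ I ^ n₁) (h₂ : W.a₂ ∈ I ^ n₂) (h3 : W.a₃ ∈ I ^ n₃) (h4 : W.a₄ ∈ I ^ n₄)
    (h6 : W.a₆ ∈ I ^ n₆)
    (i1 : e₂ ≤ n₁ + n₁ := by omega) (i2 : e₂ ≤ 2 + n₂ := by omega)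
    (i3 : e₄ ≤ 1 + n₄ := by omega) (i4 : e₄ ≤ n₁ + n₃ := by omega)
    (i5 : e₆ ≤ n₃ + n₃ := by omega) (i6 : e₆ ≤ 2 + n₆ := by omega)
    (i7 : e₈ ≤ n₁ + n₁ + n₆ := by omega) (i8 : e₈ ≤ 2 + (n₂ + n₆) := by omega)
    (i9 : e₈ ≤ n₁ + n₃ + n₄ := by omega) (i10 : e₈ ≤ n₂ + n₃ + n₃ := by omega)
    (i11 : e₈ ≤ n₄ + n₄ := by omega)
    (hN1 : N ≤ e₂ + e₂ + e₈ := by omega) (hN2 : N ≤ 3 + (e₄ + e₄ + e₄) := by omega)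
    (hN3 : N ≤ e₆ + e₆ := by omega) (hN4 : N ≤ e₂ + e₄ + e₆ := by omega) : W.Δ ∈ I ^ N :=
  Δ_mem_pow_of_b_of_two_mem W h2 (b₂_mem_pow_of_two_mem W h2 h1 h₂ i1 i2)
    (b₄_mem_pow_of_two_mem W h2 h1 h3 h4 i3 i4) (b₆_mem_pow_of_two_mem W h2 h3 h6 i5 i6)
    (b₈_mem_pow_of_two_mem W h2 h1 h₂ h3 h4 h6 i7 i8 i9 i10 i11) hN1 hN2 hN3 hN4

end IdealPow

/-! ### The `Iₙ*` sub-procedure when `2 ∈ 𝔪` -/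

section Loop

variable {R : Type*} [CommRing R] [IsDomain R] [IsDiscreteValuationRing R]

/-- **Round-`m` model, `2 ∈ 𝔪`: `π^{2m+8} ∣ Δ`.**  If `π ∣ a₁`, `π ∣ a₂`, `π^{m+2} ∣ a₃`,
`π^{m+3} ∣ a₄`, `π^{2m+4} ∣ a₆` and the residue characteristic is `2`, then
`ord b₂ ≥ 2`, `ord b₄ ≥ m + 3`, `ord b₆ ≥ 2m + 4`, `ord b₈ ≥ 2m + 5` and
`ord Δ ≥ min(2m + 9, 3m + 12, 4m + 8, 3m + 9) ≥ 2m + 8` (at the first exit of Silverman,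
*ATAEC* IV.9.4 Step 7, where `n = 2m + 1`, this is `ord Δ ≥ n + 7`).
[cite: SilvermanATAEC1994, IV.9.4 Step 7] -/
theorem Δ_mem_pow_of_istarRoundA_of_two_mem (h2 : (2 : R) ∈ maximalIdeal R)
    (V : WeierstrassCurve R) (m : ℕ) (h1 : V.a₁ ∈ maximalIdeal R) (h₂ : V.a₂ ∈ maximalIdeal R)
    (h3 : V.a₃ ∈ maximalIdeal R ^ (m + 2)) (h4 : V.a₄ ∈ maximalIdeal R ^ (m + 3))
    (h6 : V.a₆ ∈ maximalIdeal R ^ (2 * m + 4)) : V.Δ ∈ maximalIdeal R ^ (2 * m + 8) := by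
  have h11 : V.a₁ ∈ maximalIdeal R ^ 1 := by rwa [pow_one]
  have h21 : V.a₂ ∈ maximalIdeal R ^ 1 := by rwa [pow_one]
  exact Δ_mem_pow_of_a_of_two_mem V h2 2 (m + 3) (2 * m + 4) (2 * m + 5) h11 h21 h3 h4 h6

/-- **After the `y`-translation of round `m`, `2 ∈ 𝔪`: `π^{2m+10} ∣ Δ`.**  If `π ∣ a₁`,
`π ∣ a₂`, `π^{m+3} ∣ a₃`, `π^{m+3} ∣ a₄`, `π^{2m+5} ∣ a₆` and the residue characteristic is `2`,
then `ord b₄ ≥ m + 4`, `ord b₆ ≥ 2m + 6`, `ord b₈ ≥ 2m + 6` and `ord Δ ≥ 2m + 10` (at the second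
exit of *ATAEC* IV.9.4 Step 7, where `n = 2m + 2`, this is `ord Δ ≥ n + 8`).
[cite: SilvermanATAEC1994, IV.9.4 Step 7] -/
theorem Δ_mem_pow_of_istarRoundB_of_two_mem (h2 : (2 : R) ∈ maximalIdeal R)
    (V : WeierstrassCurve R) (m : ℕ) (h1 : V.a₁ ∈ maximalIdeal R) (h₂ : V.a₂ ∈ maximalIdeal R)
    (h3 : V.a₃ ∈ maximalIdeal R ^ (m + 3)) (h4 : V.a₄ ∈ maximalIdeal R ^ (m + 3))
    (h6 : V.a₆ ∈ maximalIdeal R ^ (2 * m + 5)) : V.Δ ∈ maximalIdeal R ^ (2 * m + 10) := by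
  have h11 : V.a₁ ∈ maximalIdeal R ^ 1 := by rwa [pow_one]
  have h21 : V.a₂ ∈ maximalIdeal R ^ 1 := by rwa [pow_one]
  exact Δ_mem_pow_of_a_of_two_mem V h2 2 (m + 4) (2 * m + 6) (2 * m + 6) h11 h21 h3 h4 h6

/-- **The `Iₙ*` loop keeps `π ^ (2⌊n/2⌋ + 8) ∣ Δ` in residue characteristic `2`** (Silverman,
*ATAEC* IV.9.4 Step 7, perfect residue field with `2 ∈ 𝔪`): if `V` is normalised for round `m`
(`π ∣ a₁`, `π ∥ a₂`, `π^{m+2} ∣ a₃`, `π^{m+3} ∣ a₄`, `π^{2m+4} ∣ a₆`) and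
`n = istarIndexAux fuel m V`, then `π ^ (2 (n / 2) + 8) ∣ Δ` — the exit `n = 2m + 1` has
`ord Δ ≥ 2m + 8 = n + 7` (`Δ_mem_pow_of_istarRoundA_of_two_mem`), the exit `n = 2m + 2` has
`ord Δ ≥ 2m + 10 = n + 8` (`Δ_mem_pow_of_istarRoundB_of_two_mem`).  The translations of each
round exist (`exists_variableChange_istarA/B_of_perfectField`) and `π ∥ a₂` survives them
(`OggBound.a₂_not_mem_sq_of_smul`), exactly as in `OggBound.Δ_mem_pow_istarIndexAux`.
[cite: SilvermanATAEC1994, IV.9.4 Step 7] -/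
theorem Δ_mem_pow_istarIndexAux_of_two_mem [PerfectField (ResidueField R)]
    (h2 : (2 : R) ∈ maximalIdeal R) :
    ∀ (fuel m : ℕ) (V : WeierstrassCurve R), V.a₁ ∈ maximalIdeal R → V.a₂ ∈ maximalIdeal R →
      V.a₂ ∉ maximalIdeal R ^ 2 → V.a₃ ∈ maximalIdeal R ^ (m + 2) →
      V.a₄ ∈ maximalIdeal R ^ (m + 3) → V.a₆ ∈ maximalIdeal R ^ (2 * m + 4) →
      V.Δ ∈ maximalIdeal R ^ (2 * (istarIndexAux fuel m V / 2) + 8) := by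
  classical
  intro fuel
  induction fuel with
  | zero =>
    intro m V h1 h₂ _ h3 h4 h6
    rw [show istarIndexAux 0 m V = 0 by delta istarIndexAux; rfl]
    exact Ideal.pow_le_pow_right (by omega)
      (Δ_mem_pow_of_istarRoundA_of_two_mem h2 V m h1 h₂ h3 h4 h6)
  | succ k ih =>
    intro m V h1 h₂ h2n h3 h4 h6
    rw [istarIndexAux_succ]
    dsimp only
    -- first test: exit `n = 2m + 1`
    by_cases hq1 : distinctRootCount
        (X ^ 2 + C (redCoeff V.a₃ (m + 2)) * X - C (redCoeff V.a₆ (2 * m + 4))) = 2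
    · rw [if_pos hq1, show 2 * ((2 * m + 1) / 2) + 8 = 2 * m + 8 by omega]
      exact Δ_mem_pow_of_istarRoundA_of_two_mem h2 V m h1 h₂ h3 h4 h6
    rw [if_neg hq1]
    -- the `y`-translation exists
    have hexA : ∃ C : WeierstrassCurve.VariableChange R, C.u = 1 ∧
        (C • V).a₁ ∈ maximalIdeal R ∧ (C • V).a₂ ∈ maximalIdeal R ∧
        (C • V).a₃ ∈ maximalIdeal R ^ (m + 3) ∧ (C • V).a₄ ∈ maximalIdeal R ^ (m + 3) ∧
        (C • V).a₆ ∈ maximalIdeal R ^ (2 * m + 5) :=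
      exists_variableChange_istarA_of_perfectField h1 h₂ h3 h4 h6 hq1
    rw [dif_pos hexA]
    obtain ⟨hu1, hA₁, hA₂, hA₃, hA₄, hA₆⟩ := hexA.choose_spec
    set V1 := hexA.choose • V with hV1
    have hΔ1 : V1.Δ = V.Δ := Δ_smul_of_u_eq_one hu1 _
    have hA₂n : V1.a₂ ∉ maximalIdeal R ^ 2 :=
      OggBound.a₂_not_mem_sq_of_smul hu1 h1 h₂ h2n (Ideal.pow_le_pow_right (by omega) h3)
        (Ideal.pow_le_pow_right (by omega) h4) (Ideal.pow_le_pow_right (by omega) h6) hA₁ hA₂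
        (Ideal.pow_le_pow_right (by omega) hA₃) (Ideal.pow_le_pow_right (by omega) hA₄)
        (Ideal.pow_le_pow_right (by omega) hA₆)
    -- second test: exit `n = 2m + 2`
    by_cases hq2 : distinctRootCount (C (redCoeff V1.a₂ 1) * X ^ 2 +
        C (redCoeff V1.a₄ (m + 3)) * X + C (redCoeff V1.a₆ (2 * m + 5))) = 2
    · rw [if_pos hq2, ← hΔ1, show 2 * ((2 * m + 2) / 2) + 8 = 2 * m + 10 by omega]
      exact Δ_mem_pow_of_istarRoundB_of_two_mem h2 V1 m hA₁ hA₂ hA₃ hA₄ hA₆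
    rw [if_neg hq2]
    -- the `x`-translation exists
    have hexB : ∃ C : WeierstrassCurve.VariableChange R, C.u = 1 ∧
        (C • V1).a₁ ∈ maximalIdeal R ∧ (C • V1).a₂ ∈ maximalIdeal R ∧
        (C • V1).a₃ ∈ maximalIdeal R ^ (m + 3) ∧ (C • V1).a₄ ∈ maximalIdeal R ^ (m + 4) ∧
        (C • V1).a₆ ∈ maximalIdeal R ^ (2 * m + 6) :=
      exists_variableChange_istarB_of_perfectField hA₁ hA₂ hA₂n hA₃ hA₄ hA₆ hq2
    rw [dif_pos hexB]
    obtain ⟨hu2, hB₁, hB₂, hB₃, hB₄, hB₆⟩ := hexB.choose_spec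
    set V2 := hexB.choose • V1 with hV2
    have hΔ2 : V2.Δ = V.Δ := (Δ_smul_of_u_eq_one hu2 _).trans hΔ1
    have hB₂n : V2.a₂ ∉ maximalIdeal R ^ 2 :=
      OggBound.a₂_not_mem_sq_of_smul hu2 hA₁ hA₂ hA₂n (Ideal.pow_le_pow_right (by omega) hA₃)
        (Ideal.pow_le_pow_right (by omega) hA₄) (Ideal.pow_le_pow_right (by omega) hA₆) hB₁ hB₂
        (Ideal.pow_le_pow_right (by omega) hB₃) (Ideal.pow_le_pow_right (by omega) hB₄)
        (Ideal.pow_le_pow_right (by omega) hB₆)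
    have key := ih (m + 1) V2 hB₁ hB₂ hB₂n hB₃ hB₄
      (by rw [show 2 * (m + 1) + 4 = 2 * m + 6 by ring]; exact hB₆)
    rw [hΔ2] at key
    exact key

/-- **Step 7 in residue characteristic `2`: `π ^ (2⌊n/2⌋ + 8) ∣ Δ` for the index
`n = istarIndex V`** of a step-6 normalised model whose cubic has exactly two distinct roots
(perfect residue field, `2 ∈ 𝔪`).  The initial translation exists
(`exists_variableChange_step7_of_perfectField`) and yields `π ∥ a₂` whichever admissible change
is chosen (`OggBound.t_mem_sq_of_smul`, `OggBound.cubicStep6_smul`), as in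
`OggBound.Δ_mem_pow_istarIndex`; then `Δ_mem_pow_istarIndexAux_of_two_mem`.
[cite: SilvermanATAEC1994, IV.9.4 Step 7] -/
theorem Δ_mem_pow_istarIndex_of_two_mem [PerfectField (ResidueField R)]
    (h2 : (2 : R) ∈ maximalIdeal R) {V : WeierstrassCurve R}
    (h1 : V.a₁ ∈ maximalIdeal R) (h₂ : V.a₂ ∈ maximalIdeal R) (h3 : V.a₃ ∈ maximalIdeal R ^ 2)
    (h4 : V.a₄ ∈ maximalIdeal R ^ 2) (h6 : V.a₆ ∈ maximalIdeal R ^ 3)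
    (hP : distinctRootCount (cubicStep6 V) = 2) :
    V.Δ ∈ maximalIdeal R ^ (2 * (istarIndex V / 2) + 8) := by
  classical
  have hex : ∃ C : WeierstrassCurve.VariableChange R, C.u = 1 ∧
      (C • V).a₁ ∈ maximalIdeal R ∧ (C • V).a₂ ∈ maximalIdeal R ∧ (C • V).a₃ ∈ maximalIdeal R ^ 2 ∧
      (C • V).a₄ ∈ maximalIdeal R ^ 3 ∧ (C • V).a₆ ∈ maximalIdeal R ^ 4 :=
    exists_variableChange_step7_of_perfectField h1 h₂ h3 h4 h6 hP
  unfold istarIndex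
  dsimp only
  rw [dif_pos hex]
  obtain ⟨hu7, hA₁, hA₂, hA₃, hA₄, hA₆⟩ := hex.choose_spec
  set V7 := hex.choose • V with hV7
  have hΔ7 : V7.Δ = V.Δ := Δ_smul_of_u_eq_one hu7 _
  -- `π ∥ a₂ (V7)`: the cubic of `V7` is a translate of that of `V` and equals `T³ + a₂,₁ T²`
  have hA₂n : V7.a₂ ∉ maximalIdeal R ^ 2 := by
    obtain ⟨hr, hs, ht⟩ := OggBound.t_mem_sq_of_smul hu7 h1 h₂ h3 h4 h6 hA₁ hA₂ hA₃
      (Ideal.pow_le_pow_right (by norm_num) hA₄) (Ideal.pow_le_pow_right (by norm_num) hA₆)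
    obtain ⟨c, hc⟩ := OggBound.cubicStep6_smul hu7 h1 h₂ h3 h4 h6 hr hs ht
    intro hA₂2
    obtain ⟨p, hp⟩ := mem_maximalIdeal_iff_dvd.mp hA₂
    obtain ⟨q, hq⟩ := mem_maximalIdeal_pow_iff_dvd.mp hA₄
    obtain ⟨w, hw⟩ := mem_maximalIdeal_pow_iff_dvd.mp hA₆
    have hϖ : residue R (uniformizer R) = 0 :=
      OggBound.residue_eq_zero_of_mem uniformizer_mem_maximalIdeal
    have hp0 : residue R p = 0 := by
      have h' : uniformizer R ^ 1 * 1 * p ∈ maximalIdeal R ^ (1 + 1) := by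
        rw [pow_one, mul_one, ← hp]; exact hA₂2
      have := OggBound.mem_pow_of_uniformizer_pow_mul_mem isUnit_one h'
      rw [pow_one] at this
      exact OggBound.residue_eq_zero_of_mem this
    have hq0 : residue R (uniformizer R * q) = 0 := by rw [map_mul, hϖ, zero_mul]
    have hw0 : residue R (uniformizer R * w) = 0 := by rw [map_mul, hϖ, zero_mul]
    have hcubic7 : cubicStep6 V7 = X ^ 3 + C 0 * X ^ 2 + C 0 * X + C 0 := by
      rw [cubicStep6_eq (q := uniformizer R * q) (r := uniformizer R * w) hp (by rw [hq]; ring)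
        (by rw [hw]; ring), hp0, hq0, hw0]
    have := OggBound.distinctRootCount_comp_X_add_C (cubicStep6 V) c
    rw [← hc, hcubic7, OggBound.distinctRootCount_cube, hP] at this
    exact absurd this (by norm_num)
  have key := Δ_mem_pow_istarIndexAux_of_two_mem h2 (addVal R V.Δ).toNat 0 V7 hA₁ hA₂ hA₂n
    (by simpa using hA₃) (by simpa using hA₄) (by simpa using hA₆)
  rw [hΔ7] at key
  exact key

/-- **Output `Iₙ*`, `n ≥ 1`, in residue characteristic `2`: `ord Δ ≥ 2⌊n/2⌋ + 8`** (perfect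
residue field, `2 ∈ 𝔪`, `Δ ≠ 0`).  If the literal implementation `kodairaSymbolOfMinimal` returns
`Istar (n + 1)`, then Steps 1–6 failed and Step 7 fired with `istarIndex = n + 1` on the
Step-2/Step-6 normalised model (`tateTree_eq_Istar_succ_iff`,
`exists_variableChange_step{2,6}_of_perfectField`, as in
`addVal_Δ_toNat_eq_of_kodairaSymbolOfMinimal_eq_Istar_succ`), and
`Δ_mem_pow_istarIndex_of_two_mem` applies.  Silverman, *ATAEC* IV.9.4 Step 7 with `2 ∈ 𝔪`:
`ord Δ ≥ (n + 1) + 7`, and `≥ (n + 1) + 8` when `n + 1` is even (cf. "if `p ≠ 2` then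
`n = v(Δ) - 6`", PDF p. 346). [cite: SilvermanATAEC1994, IV.9.4 Step 7] -/
theorem le_addVal_Δ_toNat_of_kodairaSymbolOfMinimal_eq_Istar_succ_of_two_mem
    [PerfectField (ResidueField R)] (h2 : (2 : R) ∈ maximalIdeal R) (V : WeierstrassCurve R)
    (hΔ0 : V.Δ ≠ 0) {n : ℕ} (hV : V.kodairaSymbolOfMinimal = .Istar (n + 1)) :
    2 * ((n + 1) / 2) + 8 ≤ (addVal R V.Δ).toNat := by
  classical
  have hϖ : Irreducible (uniformizer R) := irreducible_uniformizer
  unfold WeierstrassCurve.kodairaSymbolOfMinimal at hV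
  obtain ⟨h1, h2', h3, h4, h5, h6, h7, hidx⟩ :=
    (tateTree_eq_Istar_succ_iff _ _ _ _ _ _ _ _ _ _ _ _ _).mp hV
  rw [not_not] at h1 h2' h3 h4 h5
  -- Steps 2 and 6
  have hex2 := exists_variableChange_step2_of_perfectField V h1
  have hN2 : normalizeStep2 V = hex2.choose • V := dif_pos hex2
  obtain ⟨hu2, hA₃, hA₄, -⟩ := hex2.choose_spec
  rw [hN2] at h2' h3 h4 h5 h6 h7 hidx
  have hex6 := exists_variableChange_step6_of_perfectField h2' hA₃ hA₄ h3 h5 h4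
  have hN6 : normalizeStep6 (hex2.choose • V) = hex6.choose • (hex2.choose • V) :=
    dif_pos hex6
  obtain ⟨hu6, hB₁, hB₂, hB₃, hB₄, hB₆⟩ := hex6.choose_spec
  rw [hN6] at h6 h7 hidx
  set W₆ := hex6.choose • (hex2.choose • V) with hW₆
  have hΔ6 : W₆.Δ = V.Δ := by rw [hW₆, Δ_smul_of_u_eq_one hu6, Δ_smul_of_u_eq_one hu2]
  have hmem := Δ_mem_pow_istarIndex_of_two_mem h2 hB₁ hB₂ hB₃ hB₄ hB₆ h7
  rw [hidx, hΔ6] at hmem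
  exact le_addVal_toNat_of_pow_dvd hϖ hΔ0 (mem_maximalIdeal_pow_iff_dvd.mp hmem)

/-- **`ord Δ ≥ n + 7` for the output `Iₙ*`, `n ≥ 1`, in residue characteristic `2`**, i.e.
`f = ord Δ + 1 - (n + 5) ≥ 3`: type `Iₙ*` with `n ≥ 1` is wildly ramified whenever the residue
characteristic is `2` (Silverman, *ATAEC* IV.9.4 Step 7 with `2 ∈ 𝔪`; stated for
`Istar (n + 1)` as `n + 8 ≤ ord Δ`). [cite: SilvermanATAEC1994, IV.9.4 Step 7] -/
theorem succ_add_seven_le_addVal_Δ_toNat_of_kodairaSymbolOfMinimal_eq_Istar_succ_of_two_mem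
    [PerfectField (ResidueField R)] (h2 : (2 : R) ∈ maximalIdeal R) (V : WeierstrassCurve R)
    (hΔ0 : V.Δ ≠ 0) {n : ℕ} (hV : V.kodairaSymbolOfMinimal = .Istar (n + 1)) :
    n + 8 ≤ (addVal R V.Δ).toNat := by
  have := le_addVal_Δ_toNat_of_kodairaSymbolOfMinimal_eq_Istar_succ_of_two_mem h2 V hΔ0 hV
  omega

/-- **`ord Δ ≥ n + 8` for the output `Iₙ*` with `n ≥ 2` even, in residue characteristic `2`**
(the second exit of *ATAEC* IV.9.4 Step 7; `f ≥ 4` for these). Stated for `Istar (n + 1)` with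
`n + 1` even as `n + 9 ≤ ord Δ`. [cite: SilvermanATAEC1994, IV.9.4 Step 7] -/
theorem succ_add_eight_le_addVal_Δ_toNat_of_kodairaSymbolOfMinimal_eq_Istar_succ_of_even
    [PerfectField (ResidueField R)] (h2 : (2 : R) ∈ maximalIdeal R) (V : WeierstrassCurve R)
    (hΔ0 : V.Δ ≠ 0) {n : ℕ} (hV : V.kodairaSymbolOfMinimal = .Istar (n + 1))
    (hn : Even (n + 1)) : n + 9 ≤ (addVal R V.Δ).toNat := by
  have := le_addVal_Δ_toNat_of_kodairaSymbolOfMinimal_eq_Istar_succ_of_two_mem h2 V hΔ0 hV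
  obtain ⟨k, hk⟩ := hn
  omega

end Loop

end CharTwo

end TateAlgorithm

end Literature.NumberTheory.DiophantineGeometry

/-! ## At a place of residue characteristic `2` -/

namespace WeierstrassCurve

open scoped NumberField
open IsDedekindDomain Literature.NumberTheory.DiophantineGeometry
  Literature.NumberTheory.DiophantineGeometry.TateAlgorithm
  Literature.NumberTheory.DiophantineGeometry.TateAlgorithm.CharTwo
  Literature.NumberTheory.EllipticCurves

section Local

variable {A : Type*} [CommRing A] [IsDedekindDomain A] {K : Type*} [Field K]
  [Algebra A K] [IsFractionRing A K] (v : HeightOneSpectrum A) (W : WeierstrassCurve K)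

/-- **Type `Iₙ*`, `n ≥ 1`, at a place of residue characteristic `2`: `ord_v(Δ_min) ≥ n + 7`,
and `≥ n + 8` if `n` is even** (elliptic `W`, perfect residue field of `O_v`, `2 ∈ 𝔪_v`): Tate's
algorithm on the integral local minimal model (`kodairaSymbolAt_def`,
`le_addVal_Δ_toNat_of_kodairaSymbolOfMinimal_eq_Istar_succ_of_two_mem`).  Stated for
`Istar (n + 1)`. [cite: SilvermanATAEC1994, IV.9.4 Step 7] -/
theorem le_ordMinimalDiscriminant_of_kodairaSymbolAt_eq_Istar_succ_of_two_mem [W.IsElliptic]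
    [PerfectField (IsLocalRing.ResidueField (v.adicCompletionIntegers K))]
    (h2 : (2 : v.adicCompletionIntegers K) ∈ IsLocalRing.maximalIdeal _) {n : ℕ}
    (hT : W.kodairaSymbolAt v = .Istar (n + 1)) :
    n + 8 ≤ W.ordMinimalDiscriminant v ∧ (Even (n + 1) → n + 9 ≤ W.ordMinimalDiscriminant v) := by
  rw [kodairaSymbolAt_def] at hT
  have h := le_addVal_Δ_toNat_of_kodairaSymbolOfMinimal_eq_Istar_succ_of_two_mem h2 _
    (localMinimalIntegralModel_Δ_ne_zero v W) hT
  have h' : 2 * ((n + 1) / 2) + 8 ≤ W.ordMinimalDiscriminant v := h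
  refine ⟨by omega, fun hn ↦ ?_⟩
  obtain ⟨k, hk⟩ := hn
  omega

/-- **Type `Iₙ*`, `n ≥ 1`, is wild in residue characteristic `2`: `f_v ≥ 3`, and `f_v ≥ 4` if
`n` is even** (Ogg's formula `f_v = ord_v(Δ_min) + 1 - m_v` being the definition of
`conductorExponent`, with `m_v = n + 5`).  Stated for `Istar (n + 1)`.
[cite: SilvermanATAEC1994, IV.9.4 Step 7 and Table 4.1] -/
theorem three_le_conductorExponent_of_kodairaSymbolAt_eq_Istar_succ_of_two_mem [W.IsElliptic]
    [PerfectField (IsLocalRing.ResidueField (v.adicCompletionIntegers K))]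
    (h2 : (2 : v.adicCompletionIntegers K) ∈ IsLocalRing.maximalIdeal _) {n : ℕ}
    (hT : W.kodairaSymbolAt v = .Istar (n + 1)) :
    3 ≤ W.conductorExponent v ∧ (Even (n + 1) → 4 ≤ W.conductorExponent v) := by
  obtain ⟨h1, h2'⟩ :=
    W.le_ordMinimalDiscriminant_of_kodairaSymbolAt_eq_Istar_succ_of_two_mem v h2 hT
  unfold conductorExponent numComponentsAt
  rw [hT, KodairaSymbol.numComponents_Istar]
  refine ⟨by omega, fun hn ↦ ?_⟩
  have := h2' hn
  omega

/-- **The additive types with `f_v = 2` at an absolutely unramified `2`-adic place are `IV`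
(`ord_v(Δ_min) = 4`) and `IV*` (`ord_v(Δ_min) = 8`).**  Let `2` be a uniformiser of `O_v`
(perfect residue field) and `W` elliptic with `f_v = 2`.  Then `W` has additive reduction
(`two_le_conductorExponent_iff_holds`), so the Kodaira symbol is additive
(`isAdditive_kodairaSymbolAt_iff_holds`), and `f_v = ord_v(Δ_min) + 1 - m_v` excludes, by the
discriminant values on each branch of Tate's algorithm with `π = 2`: `II` (`ord Δ ∈ {4, 6, 7}`,
`f ∈ {4, 6, 7}`), `III` (`{4, 6, 8, 9}`, `f ∈ {3, 5, 7, 8}`), `I₀*` (`{8, 9, 10}`,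
`f ∈ {4, 5, 6}`), `Iₙ*` with `n ≥ 1` (`ord Δ ≥ n + 7`, `f ≥ 3`;
`three_le_conductorExponent_of_kodairaSymbolAt_eq_Istar_succ_of_two_mem`), `III*`
(`{10, 12, 14, 15}`, `f ∈ {3, 5, 7, 8}`), `II*` (`{11, 12, 14}`, `f ∈ {3, 4, 6}`); the types `IV`
(`m = 3`) and `IV*` (`m = 7`) remain, with `ord_v(Δ_min) = f + m - 1 = 4`, resp. `8`.
Silverman, *ATAEC* IV.9.4 and Table 4.1 with `π = 2`; this is the `v(N) = 2` row structure of
Papadopoulos's table for `p = 2`.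
[cite: SilvermanATAEC1994, IV.9.4 and Table 4.1] [cite: Papadopoulos1993, Table IV (p = 2)] -/
theorem kodairaSymbolAt_of_conductorExponent_eq_two_of_irreducible_two [W.IsElliptic]
    [PerfectField (IsLocalRing.ResidueField (v.adicCompletionIntegers K))]
    (h2 : Irreducible (2 : v.adicCompletionIntegers K)) (hf : W.conductorExponent v = 2) :
    (W.kodairaSymbolAt v = .IV ∧ W.ordMinimalDiscriminant v = 4) ∨
      (W.kodairaSymbolAt v = .IVstar ∧ W.ordMinimalDiscriminant v = 8) := by
  have h2m : (2 : v.adicCompletionIntegers K) ∈ IsLocalRing.maximalIdeal _ :=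
    (IsLocalRing.mem_maximalIdeal _).mpr h2.not_isUnit
  have hadd : (W.kodairaSymbolAt v).IsAdditive :=
    (isAdditive_kodairaSymbolAt_iff_holds v W).mpr
      ((two_le_conductorExponent_iff_holds v W).mp (by omega))
  have hΔ0 := localMinimalIntegralModel_Δ_ne_zero v W
  have hf' := hf
  unfold conductorExponent numComponentsAt at hf'
  -- the Istar branch, before generalising the symbol
  have hIstar : ∀ n, W.kodairaSymbolAt v = .Istar (n + 1) → False := fun n hT ↦ by
    have := (W.three_le_conductorExponent_of_kodairaSymbolAt_eq_Istar_succ_of_two_mem v h2m hT).1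
    omega
  generalize hT : W.kodairaSymbolAt v = T at hadd hf' hIstar
  have hV : (W.localMinimalIntegralModel v).kodairaSymbolOfMinimal = T := by
    rw [← kodairaSymbolAt_def]; exact hT
  cases T with
  | I n => exact absurd hadd (KodairaSymbol.not_isAdditive_I n)
  | II =>
    exfalso
    have h : W.ordMinimalDiscriminant v = 4 ∨ W.ordMinimalDiscriminant v = 6 ∨
        W.ordMinimalDiscriminant v = 7 :=
      LocalIndex.addVal_Δ_toNat_eq_of_kodairaSymbolOfMinimal_eq_II_of_two h2 _ hV
    rw [show KodairaSymbol.numComponents .II = 1 from rfl] at hf'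
    omega
  | III =>
    exfalso
    have h : W.ordMinimalDiscriminant v = 4 ∨ W.ordMinimalDiscriminant v = 6 ∨
        W.ordMinimalDiscriminant v = 8 ∨ W.ordMinimalDiscriminant v = 9 :=
      LocalIndex.addVal_Δ_toNat_eq_of_kodairaSymbolOfMinimal_eq_III_of_two h2 _ hV
    rw [show KodairaSymbol.numComponents .III = 2 from rfl] at hf'
    omega
  | IV =>
    rw [show KodairaSymbol.numComponents .IV = 3 from rfl] at hf'
    exact Or.inl ⟨rfl, by omega⟩
  | Istar n =>
    exfalso
    cases n with
    | zero =>
      have h : W.ordMinimalDiscriminant v = 8 ∨ W.ordMinimalDiscriminant v = 9 ∨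
          W.ordMinimalDiscriminant v = 10 :=
        LocalIndex.addVal_Δ_toNat_eq_of_kodairaSymbolOfMinimal_eq_Istar_zero_of_two h2 _ hΔ0 hV
      rw [show KodairaSymbol.numComponents (.Istar 0) = 5 from rfl] at hf'
      omega
    | succ n => exact hIstar n rfl
  | IVstar =>
    rw [show KodairaSymbol.numComponents .IVstar = 7 from rfl] at hf'
    exact Or.inr ⟨rfl, by omega⟩
  | IIIstar =>
    exfalso
    have h : W.ordMinimalDiscriminant v = 10 ∨ W.ordMinimalDiscriminant v = 12 ∨
        W.ordMinimalDiscriminant v = 14 ∨ W.ordMinimalDiscriminant v = 15 :=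
      LocalIndex.addVal_Δ_toNat_eq_of_kodairaSymbolOfMinimal_eq_IIIstar_of_two h2 _ hV
    rw [show KodairaSymbol.numComponents .IIIstar = 8 from rfl] at hf'
    omega
  | IIstar =>
    exfalso
    have h : W.ordMinimalDiscriminant v = 11 ∨ W.ordMinimalDiscriminant v = 12 ∨
        W.ordMinimalDiscriminant v = 14 :=
      LocalIndex.addVal_Δ_toNat_eq_of_kodairaSymbolOfMinimal_eq_IIstar_of_two h2 _ hV
    rw [show KodairaSymbol.numComponents .IIstar = 9 from rfl] at hf'
    omega

end Local

/-! ## Over `ℚ` at `2` -/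

section Rat

variable (W : WeierstrassCurve ℚ)

/-- Over `ℚ`: if the prime below `v` is `2` then `2` is a uniformiser of `O_v ≃ ℤ₂`
(`Rat.irreducible_natCast_natGenerator`). [folklore] -/
private theorem irreducible_two_adicCompletionIntegers_of_natGenerator_eq_two (v : HeightOneSpectrum ℤ)
    (hv : Rat.HeightOneSpectrum.natGenerator v = 2) :
    Irreducible (2 : v.adicCompletionIntegers ℚ) := by
  have h := Literature.NumberTheory.DiophantineGeometry.Rat.irreducible_natCast_natGenerator v
  rw [hv] at h
  simpa using h

/-- **Type `Iₙ*`, `n ≥ 1`, at `2` over `ℚ`: `ord₂(Δ_min) ≥ n + 7` (`≥ n + 8` for even `n`) and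
`f₂ ≥ 3` (`≥ 4` for even `n`)** — stated for `Istar (n + 1)` at a place `v` of `ℤ` above `2`.
[cite: SilvermanATAEC1994, IV.9.4 Step 7 and Table 4.1] -/
theorem le_ordMinimalDiscriminant_of_kodairaSymbolAt_eq_Istar_succ_two [W.IsElliptic]
    (v : HeightOneSpectrum ℤ) (hv : Rat.HeightOneSpectrum.natGenerator v = 2) {n : ℕ}
    (hT : W.kodairaSymbolAt v = .Istar (n + 1)) :
    (n + 8 ≤ W.ordMinimalDiscriminant v ∧ (Even (n + 1) → n + 9 ≤ W.ordMinimalDiscriminant v)) ∧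
      (3 ≤ W.conductorExponent v ∧ (Even (n + 1) → 4 ≤ W.conductorExponent v)) := by
  have h2m : (2 : v.adicCompletionIntegers ℚ) ∈ IsLocalRing.maximalIdeal _ :=
    (IsLocalRing.mem_maximalIdeal _).mpr
      (irreducible_two_adicCompletionIntegers_of_natGenerator_eq_two v hv).not_isUnit
  exact ⟨W.le_ordMinimalDiscriminant_of_kodairaSymbolAt_eq_Istar_succ_of_two_mem v h2m hT,
    W.three_le_conductorExponent_of_kodairaSymbolAt_eq_Istar_succ_of_two_mem v h2m hT⟩

/-- The same at a place `v` of `𝓞 ℚ` containing `2` (the convention of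
`KodairaDiscriminantValuesTwoProofs`; `irreducible_two_adicCompletionIntegers`).
[cite: SilvermanATAEC1994, IV.9.4 Step 7 and Table 4.1] -/
theorem le_ordMinimalDiscriminant_of_kodairaSymbolAt_eq_Istar_succ_two' [W.IsElliptic]
    {v : HeightOneSpectrum (𝓞 ℚ)} (hv : (2 : 𝓞 ℚ) ∈ v.asIdeal) {n : ℕ}
    (hT : W.kodairaSymbolAt v = .Istar (n + 1)) :
    (n + 8 ≤ W.ordMinimalDiscriminant v ∧ (Even (n + 1) → n + 9 ≤ W.ordMinimalDiscriminant v)) ∧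
      (3 ≤ W.conductorExponent v ∧ (Even (n + 1) → 4 ≤ W.conductorExponent v)) := by
  have h2irr := irreducible_two_adicCompletionIntegers v (Rat.valuation_two_of_two_mem hv)
  have h2m : (2 : v.adicCompletionIntegers ℚ) ∈ IsLocalRing.maximalIdeal _ :=
    (IsLocalRing.mem_maximalIdeal _).mpr h2irr.not_isUnit
  exact ⟨W.le_ordMinimalDiscriminant_of_kodairaSymbolAt_eq_Istar_succ_of_two_mem v h2m hT,
    W.three_le_conductorExponent_of_kodairaSymbolAt_eq_Istar_succ_of_two_mem v h2m hT⟩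

/-- **`f₂ = 2` over `ℚ` forces type `IV` with `ord₂(Δ_min) = 4` or type `IV*` with
`ord₂(Δ_min) = 8`** (place `v` of `ℤ` above `2`).
[cite: SilvermanATAEC1994, IV.9.4 and Table 4.1] [cite: Papadopoulos1993, Table IV (p = 2)] -/
theorem kodairaSymbolAt_of_conductorExponent_eq_two_two [W.IsElliptic] (v : HeightOneSpectrum ℤ)
    (hv : Rat.HeightOneSpectrum.natGenerator v = 2) (hf : W.conductorExponent v = 2) :
    (W.kodairaSymbolAt v = .IV ∧ W.ordMinimalDiscriminant v = 4) ∨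
      (W.kodairaSymbolAt v = .IVstar ∧ W.ordMinimalDiscriminant v = 8) :=
  W.kodairaSymbolAt_of_conductorExponent_eq_two_of_irreducible_two v
    (irreducible_two_adicCompletionIntegers_of_natGenerator_eq_two v hv) hf

/-- The same at a place `v` of `𝓞 ℚ` containing `2`.
[cite: SilvermanATAEC1994, IV.9.4 and Table 4.1] [cite: Papadopoulos1993, Table IV (p = 2)] -/
theorem kodairaSymbolAt_of_conductorExponent_eq_two_two' [W.IsElliptic]
    {v : HeightOneSpectrum (𝓞 ℚ)} (hv : (2 : 𝓞 ℚ) ∈ v.asIdeal) (hf : W.conductorExponent v = 2) :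
    (W.kodairaSymbolAt v = .IV ∧ W.ordMinimalDiscriminant v = 4) ∨
      (W.kodairaSymbolAt v = .IVstar ∧ W.ordMinimalDiscriminant v = 8) :=
  W.kodairaSymbolAt_of_conductorExponent_eq_two_of_irreducible_two v
    (irreducible_two_adicCompletionIntegers v (Rat.valuation_two_of_two_mem hv)) hf

/-- `4 ∥ N_E` means `f₂ = 2` at the place `v` of `ℤ` above `2`: the conductor is
`N_E = ∏ p ^ f_p` (Silverman, *AEC* C.16; `factorization_conductorNorm_holds`).
[cite: SilvermanAEC2009, C.16] -/
theorem conductorExponent_eq_two_of_four_dvd_conductorNorm [W.IsElliptic] (v : HeightOneSpectrum ℤ)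
    (hv : Rat.HeightOneSpectrum.natGenerator v = 2) (h4 : 2 ^ 2 ∣ W.conductorNorm ℤ)
    (h8 : ¬ 2 ^ 3 ∣ W.conductorNorm ℤ) : W.conductorExponent v = 2 := by
  have hN : W.conductorNorm ℤ ≠ 0 := (conductorNorm_pos_holds W).ne'
  have hfac : (W.conductorNorm ℤ).factorization 2 = W.conductorExponent v := by
    rw [← hv]; exact factorization_conductorNorm_holds W v
  rw [Nat.prime_two.pow_dvd_iff_le_factorization hN, hfac] at h4 h8
  omega

/-- For a globally minimal equation, `ord_v(Δ_min) = ord_p(Δ_min(W))` at the place `v` of `ℤ`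
above `p` (`factorization_minimalDiscriminantNorm_holds`,
`minimalDiscriminantNorm_int_eq_natAbs_minimalDiscriminantInt_holds`).
[cite: SilvermanAEC2009, VIII.8] -/
theorem ordMinimalDiscriminant_eq_padicValInt_natGenerator' [W.IsElliptic] [W.IsGloballyMinimal]
    (v : HeightOneSpectrum ℤ) :
    W.ordMinimalDiscriminant v =
      padicValInt (Rat.HeightOneSpectrum.natGenerator v) W.minimalDiscriminantInt := by
  rw [← W.factorization_minimalDiscriminantNorm_holds v,
    minimalDiscriminantNorm_int_eq_natAbs_minimalDiscriminantInt_holds W,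
    Nat.factorization_def _ (Rat.HeightOneSpectrum.prime_natGenerator v)]
  rfl

/-- **`4 ∥ N_E ⇒ ord₂(Δ_min) ∈ {4, 8}`, with Kodaira type `IV`, resp. `IV*`, at `2`** for an
elliptic curve over `ℚ` given by a globally minimal equation (`v` the place of `ℤ` above `2`):
`kodairaSymbolAt_of_conductorExponent_eq_two_two` in the global currency
(`conductorExponent_eq_two_of_four_dvd_conductorNorm`,
`ordMinimalDiscriminant_eq_padicValInt_natGenerator'`).
[cite: SilvermanATAEC1994, IV.9.4 and Table 4.1] [cite: Papadopoulos1993, Table IV (p = 2)] -/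
theorem kodairaSymbolAt_of_four_dvd_conductorNorm [W.IsElliptic] [W.IsGloballyMinimal]
    (v : HeightOneSpectrum ℤ) (hv : Rat.HeightOneSpectrum.natGenerator v = 2)
    (h4 : 2 ^ 2 ∣ W.conductorNorm ℤ) (h8 : ¬ 2 ^ 3 ∣ W.conductorNorm ℤ) :
    (W.kodairaSymbolAt v = .IV ∧ padicValInt 2 W.minimalDiscriminantInt = 4) ∨
      (W.kodairaSymbolAt v = .IVstar ∧ padicValInt 2 W.minimalDiscriminantInt = 8) := by
  have hΔ : padicValInt 2 W.minimalDiscriminantInt = W.ordMinimalDiscriminant v := by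
    rw [W.ordMinimalDiscriminant_eq_padicValInt_natGenerator' v, hv]
  rw [hΔ]
  exact W.kodairaSymbolAt_of_conductorExponent_eq_two_two v hv
    (W.conductorExponent_eq_two_of_four_dvd_conductorNorm v hv h4 h8)

/-- **`4 ∥ N_E ⇒ ord₂(Δ_min) = 4` or `8`** for an elliptic curve over `ℚ` given by a globally
minimal equation — the law "`4 ∥ N ⇒ v₂(Δ_min) ∈ {4, 8}`" at the place
`v₂ = primesEquiv.symm 2` of `ℤ`. [cite: SilvermanATAEC1994, IV.9.4 and Table 4.1]
[cite: Papadopoulos1993, Table IV (p = 2)] -/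
theorem padicValInt_two_minimalDiscriminantInt_of_four_dvd_conductorNorm [W.IsElliptic]
    [W.IsGloballyMinimal] (h4 : 2 ^ 2 ∣ W.conductorNorm ℤ) (h8 : ¬ 2 ^ 3 ∣ W.conductorNorm ℤ) :
    padicValInt 2 W.minimalDiscriminantInt = 4 ∨ padicValInt 2 W.minimalDiscriminantInt = 8 := by
  set v : HeightOneSpectrum ℤ := (Rat.HeightOneSpectrum.primesEquiv (R := ℤ)).symm ⟨2, Nat.prime_two⟩
    with hvdef
  have hv : Rat.HeightOneSpectrum.natGenerator v = 2 :=
    congrArg Subtype.val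
      ((Rat.HeightOneSpectrum.primesEquiv (R := ℤ)).apply_symm_apply ⟨2, Nat.prime_two⟩)
  rcases W.kodairaSymbolAt_of_four_dvd_conductorNorm v hv h4 h8 with ⟨-, h⟩ | ⟨-, h⟩
  · exact Or.inl h
  · exact Or.inr h

end Rat

end WeierstrassCurve
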